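import Summits.ValiantsHypothesis.ValiantsHypothesis.Theorems.KPlusLogSqLawTropicalBParabolaCriterion
import Summits.ValiantsHypothesis.ValiantsHypothesis.Theorems.LacunarySymmetroidMatrixDescartesCensusTropicalKLawStatic

/-!
# Route `KPlusLogSqLaw`, crux `TropicalB` — the COUPLED-REGISTER family, part 1: DEFINITIONS
# (a rigid static `K = 3` design with `(N+1)² − 1` sign-alternating dominant breakpoints on `2N+1` nodes)

HONEST FRAMING.  Helper toward the registered stubs of `Cruxes/TropicalB/Lines/birth.lean` (crux
`Summit.ValiantsHypothesis.ValiantsHypothesis.Theses.KPlusLogSqLaw.TropicalB`, ledger item `stmt-ValiantsHypothesis-19771`,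
route `KPlusLogSqLaw`; cell `pub-symmetroid`, seat val-sym-trop-p5 (g3), refuter-adjacent lane, 2026-08-26).  This file only
DEFINES an explicit LOWER-BOUND family at `K = 3` (quadratic in the size, as counting predicts) and proves the bookkeeping
facts about its row maps; parts 2–3 (`…CoupledRegistersStates`, `…CoupledRegisters`) prove the census row.  Nothing here
says anything about `TropicalB` in its window, `WeakLifting`, `KPlusLogSqLaw`, `MatrixDescartes` (stmt-ValiantsHypothesis-18050)
or VP ≠ VNP.

THE DESIGN (the «register read through a port» mechanism of the cell's obstruction memo READS-AND-RESETS §4, val-sym-trop-p5 g2,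
there computed for `n ≤ 7`; here for all `N`, in closed form).  Size `m = 2N+1`, classes `d = (0, 1, N+1)`.  Indices `≤ N` are
the X-rows / x-columns, indices `> N` the R-rows / c-columns.  Support (one class per entry — the design is STATIC):
* X-register: c-column `b > N` meets X-row `b − N` (class 0) and X-row `b − N − 1` (class 2);
* x-register: R-row `a > N` meets x-column `a − N` (class 0) and x-column `a − N − 1` (class 1);
* couplings: X-row `j ≤ N` meets x-column `t ≤ N` (class 0), valuation `((N+1)·j + t)²`, sign `sign σ_{j,t} · (−1)^{(N+1)j+t}`;
all other valuations `0`, all register signs `+1`.  The intended terms are the `(N+1)²` STATES `σ_{j,t}` (`state`): X-register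
with hole `j`, x-register with free column `t`, coupling edge `(j, t)`; state `(j,t)` has slope `(N+1)j + t` and valuation
`((N+1)j + t)²` (part 2), the support is rigid and the chain `k ↦ σ_{k/(N+1), k%(N+1)}` (`chain`) is dominant and alternating by
val-sym-trop-p4's parabola criterion (part 3).
[folklore] (hole registers / parametric assignment gadgets; parabola heights = Viro–Itenberg style patchworking).
-/

set_option linter.dupNamespace false
set_option autoImplicit false

namespace Summit.ValiantsHypothesis.ValiantsHypothesis.Theorems.KPlusLogSqLaw

open Summit.ValiantsHypothesis.ValiantsHypothesis.Theorems.MatrixDescartes.Negative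
open Summit.ValiantsHypothesis.ValiantsHypothesis.Theorems.LacunarySymmetroidMatrixDescartes
open Summit.ValiantsHypothesis.ValiantsHypothesis.Theorems.LacunarySymmetroidMatrixDescartes.TropicalCensus
open Finset

namespace CoupledRegister

variable (N : ℕ)

/-! ## 1. The states `σ_{j,t}` -/

/-- row of column `b` in state `(j, t)` (on `ℕ`): x-columns `b ≤ N` go to `j` (if `b = t`), to R-row `N+b+1` (if `b < t`) or to
R-row `N+b` (if `b > t`); c-columns `b > N` go to X-row `b−N−1` (if `b−N ≤ j`) or `b−N` (otherwise). -/
def rowNat (j t b : ℕ) : ℕ :=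
  if b ≤ N then (if b = t then j else if b < t then N + b + 1 else N + b)
  else (if b - N ≤ j then b - N - 1 else b - N)

/-- class of column `b` in state `(j, t)`: `1` on the shifted x-columns `b < t`, `2` on the shifted c-columns `N < b ≤ N + j`,
`0` elsewhere. -/
def clsNat (j t b : ℕ) : Fin 3 :=
  if b ≤ N then (if b < t then 1 else 0) else (if b - N ≤ j then 2 else 0)

/-- the row map stays inside the matrix. -/
theorem rowNat_lt {j t b : ℕ} (hj : j ≤ N) (ht : t ≤ N) (hb : b < 2 * N + 1) : rowNat N j t b < 2 * N + 1 := by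
  unfold rowNat
  split_ifs <;> omega

/-- the row map of state `(j, t)` on `Fin (2N+1)`. -/
def rowFin (j t : Fin (N + 1)) (b : Fin (2 * N + 1)) : Fin (2 * N + 1) :=
  ⟨rowNat N j t b, rowNat_lt N (Nat.le_of_lt_succ j.isLt) (Nat.le_of_lt_succ t.isLt) b.isLt⟩

/-- value of the row map. -/
@[simp] theorem rowFin_val (j t : Fin (N + 1)) (b : Fin (2 * N + 1)) :
    ((rowFin N j t b : Fin (2 * N + 1)) : ℕ) = rowNat N j t b := rfl

/-- the row map is injective (case analysis). -/
theorem rowNat_injective {j t : ℕ} (hj : j ≤ N) (ht : t ≤ N) {b b' : ℕ} (hb : b < 2 * N + 1) (hb' : b' < 2 * N + 1)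
    (h : rowNat N j t b = rowNat N j t b') : b = b' := by
  unfold rowNat at h
  split_ifs at h <;> omega

/-- the row map is injective on `Fin (2N+1)`. -/
theorem rowFin_injective (j t : Fin (N + 1)) : Function.Injective (rowFin N j t) := by
  intro b b' h
  have h' := congrArg Fin.val h
  simp only [rowFin_val] at h'
  exact Fin.ext (rowNat_injective N (Nat.le_of_lt_succ j.isLt) (Nat.le_of_lt_succ t.isLt) b.isLt b'.isLt h')

/-- the permutation of state `(j, t)`. -/
noncomputable def perm (j t : Fin (N + 1)) : Equiv.Perm (Fin (2 * N + 1)) :=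
  Equiv.ofBijective (rowFin N j t) (rowFin_injective N j t).bijective_of_finite

/-- the state permutation is the row map. -/
@[simp] theorem perm_apply (j t : Fin (N + 1)) (b : Fin (2 * N + 1)) : perm N j t b = rowFin N j t b := by
  simp [perm]

/-- the class map of state `(j, t)`. -/
def cls (j t : Fin (N + 1)) (b : Fin (2 * N + 1)) : Fin 3 := clsNat N j t b

/-- the Leibniz term of state `(j, t)`. -/
noncomputable def state (j t : Fin (N + 1)) : Equiv.Perm (Fin (2 * N + 1)) × (Fin (2 * N + 1) → Fin 3) :=
  (perm N j t, cls N j t)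

/-! ## 2. The design -/

/-- exponents `(0, 1, N+1)`. -/
def d : Fin 3 → ℕ := ![0, 1, N + 1]

/-- valuations: `((N+1)·a + b)²` on the coupling block `a, b ≤ N`, `0` elsewhere (class-independent). -/
def v (a b : Fin (2 * N + 1)) (_l : Fin 3) : ℤ :=
  if (a : ℕ) ≤ N ∧ (b : ℕ) ≤ N then (((N + 1) * (a : ℕ) + (b : ℕ) : ℕ) : ℤ) ^ 2 else 0

/-- the coupling sign of entry `(a, b)`, `a, b ≤ N`: `sign σ_{a,b} · (−1)^{(N+1)a+b}` (so that the term sign of state `(a,b)` is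
`(−1)^{(N+1)a+b}`); `0` off the coupling block (unused there). -/
noncomputable def csign (a b : Fin (2 * N + 1)) : ℤ :=
  if h : (a : ℕ) ≤ N ∧ (b : ℕ) ≤ N then
    (Equiv.Perm.sign (perm N ⟨a, Nat.lt_succ_of_le h.1⟩ ⟨b, Nat.lt_succ_of_le h.2⟩) : ℤ) *
      (-1) ^ ((N + 1) * (a : ℕ) + (b : ℕ))
  else 0

/-- signs / support: couplings (class 0) on `a, b ≤ N`; X-register `a = b − N` (class 0), `a + 1 = b − N` (class 2) on `a ≤ N < b`;
x-register `b = a − N` (class 0), `b + 1 = a − N` (class 1) on `b ≤ N < a`; nothing on `a, b > N`. -/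
noncomputable def ε (a b : Fin (2 * N + 1)) (l : Fin 3) : ℤ :=
  if (a : ℕ) ≤ N ∧ (b : ℕ) ≤ N then (if l = 0 then csign N a b else 0)
  else if (a : ℕ) ≤ N ∧ N < (b : ℕ) then
    (if ((a : ℕ) = (b : ℕ) - N ∧ l = 0) ∨ ((a : ℕ) + 1 = (b : ℕ) - N ∧ l = 2) then 1 else 0)
  else if N < (a : ℕ) ∧ (b : ℕ) ≤ N then
    (if ((b : ℕ) = (a : ℕ) - N ∧ l = 0) ∨ ((b : ℕ) + 1 = (a : ℕ) - N ∧ l = 1) then 1 else 0)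
  else 0

/-! ## 3. Small indices, the support predicate, the chain -/

/-- small indices as indices of the big matrix. -/
def emb (j : Fin (N + 1)) : Fin (2 * N + 1) := ⟨j, by omega⟩

/-- value of the embedding of small indices. -/
@[simp] theorem emb_val (j : Fin (N + 1)) : ((emb N j : Fin (2 * N + 1)) : ℕ) = j := rfl

/-- the support, as a predicate on `(row, column, class)` (values in `ℕ`): couplings, X-register, x-register. [definition of the cell] -/
def InSupp (a b : ℕ) (l : Fin 3) : Prop :=
  (a ≤ N ∧ b ≤ N ∧ l = 0) ∨
    (a ≤ N ∧ N < b ∧ ((a = b - N ∧ l = 0) ∨ (a + 1 = b - N ∧ l = 2))) ∨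
      (N < a ∧ b ≤ N ∧ ((b = a - N ∧ l = 0) ∨ (b + 1 = a - N ∧ l = 1)))
/-- digits of the chain index. -/
theorem div_lt_succ (k : Fin (N * N + 2 * N + 1)) : (k : ℕ) / (N + 1) < N + 1 := by
  rw [Nat.div_lt_iff_lt_mul (Nat.succ_pos N)]
  have := k.isLt
  nlinarith

/-- the `k`-th chain term: the state with digits `(k / (N+1), k % (N+1))`. -/
noncomputable def chain (k : Fin (N * N + 2 * N + 1)) : Equiv.Perm (Fin (2 * N + 1)) × (Fin (2 * N + 1) → Fin 3) :=
  state N ⟨(k : ℕ) / (N + 1), div_lt_succ N k⟩ ⟨(k : ℕ) % (N + 1), Nat.mod_lt _ (Nat.succ_pos N)⟩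

end CoupledRegister

end Summit.ValiantsHypothesis.ValiantsHypothesis.Theorems.KPlusLogSqLaw
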